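import Summits.BirchSwinnertonDyer.BirchSwinnertonDyer.Theorems.ErratumRoadFiveNonSurjCornerTwinKatoRat
import Summits.BirchSwinnertonDyer.BirchSwinnertonDyer.Theorems.ByReductionTypeAtTwoMultKatoRatOfInputs

/-!
# Route `ErratumRoadFive` (rung K2a), crux 6 `NonSurjCorner` (item 19065): the twin's Euler-system half BY NAME —
# x11c's `MultDivisibilityAt` at ANY odd multiplicative pair from six NAMED Literature facts + `μ = 0`; the corner's
# twin summand is `μ = 0` ALONE modulo named facts
# (cell `bsd-stepL`, seat `bsd-stepL-corner-p1` g5; `--supports stmt-BirchSwinnertonDyer-19065`)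

Composition of this seat's `Theorems/ErratumRoadFiveNonSurjCornerTwinKatoRat.lean` (p477282: `MultDivisibilityAt W p`
⟸ `X5.O1.KatoMultiplicativeDivisibilityRat W p` + Wuthrich Cor. 18 + `μ = 0`) with the `p = 2` cell's leaf
`Theorems/ByReductionTypeAtTwoMultKatoRatOfInputs.lean` (`MultKatoRat.katoMultiplicativeDivisibilityRat_of_facts_odd`:
at every ODD prime the binder follows from Kato's §17.13 inputs at a multiplicative prime). Result:

* §1 **`multDivisibilityAt_of_katoFacts_of_corollary18_of_mu_eq_zero`** — for EVERY globally minimal `W` and every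
  ODD prime `p` of multiplicative reduction: `X11b.MultDivisibilityAt W p` (x11c's typed missing input: `X(E/ℚ_∞)`
  torsion and `ϖ·L ∈ ι(char_Λ X)` resp. `∈ ι(T·char_Λ X)`) follows from SIX NAMED Literature facts —
  `Kato2004.nonempty_iwasawaH1Data`, `Kato2004.thm12_4` (Astérisque 295 (12.2.1), Thm. 12.4 (2)(3)),
  `Kato2004.exists_multDivisibilityInputs_nonsplit`, `Kato2004.exists_multDivisibilityInputs_split` (the §17.13
  inputs at `p ∥ N`: Thm. 12.4 (1), 12.5 (1)–(3), 12.6, 16.6 (2), (17.13.1)–(17.13.3), the Coleman map of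
  Prop. 17.11 ∕ Rubin 1998 Prop. A.2 ∕ Wuthrich 2014 p. 394 ∕ Kobayashi 2006 Thm. 4.1; CONSTRUCTION facts,
  `bsd-2adic` p474627), `Greenberg1999.thm15_isTorsion_multiplicative_rat` (Kato–Rohrlich, LNM 1716 Thm. 1.5),
  `Wuthrich2014.corollary18_padicLFunction_mem_iwasawaAlgebra_multiplicative` (Cor. 18) — plus ONE hypothesis
  shape: `μ(X(E/ℚ_∞)) = 0` for every cyclotomic dual datum (Greenberg's Conj. 1.11 at the pair; rung K6's object).
  NO image hypothesis, NO (ram), NO Euler-unit certificate, NO semistability away from `p`.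
* §2 the corner: **`erratumRoadFive_nonSurjCorner_of_certificates_of_lowerX11a_of_katoFacts_of_twinMuZero :
  pubs (+ the six facts) → EulerHalfOffLocus (19062) → X11aLowerHalf (19064) → Zₚᶜ → (∀ leaf twins, μ = 0) → NonSurjCorner`**
  and the refined-Kolyvagin variant (19064 + Zₚᶜ + Jₚᶜ). The binder `hK` of p477282 §3 is GONE.

READING (for the planner ∕ rung K6; supersedes g4's §2 re-cut text on the twin conjunct). The corner's twin summand
is now EXACTLY `∀ leaf twins, ∀ cyclotomic D, D.mu = 0` (Greenberg's `μ = 0` at the non-surjective X11a leaf twins,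
`p ∈ {5,7}`, `p ∥ N`) modulo NAMED facts; a statement edit (director GO) could take `NonSurjCornerTwinMu :=` that
literal shape, glued by §2. What the facts cost: two construction facts of bsd-2adic (net debt +2 there), Kato's
12.4 ∕ (12.2.1) pins (bsd-smallim), Greenberg Thm. 1.5 and Wuthrich Cor. 18 (statement facts).

HONEST FRAMING. Theorems only (no `def`, no fact minted); CONDITIONAL on the named facts listed and on the hypothesis
shapes `h₂`/`h₄`/`hZ`/`hJ`/`hμ`; nothing here proves `μ = 0`, Zₚᶜ, Jₚᶜ or any pair's BSD; item 19065 does NOT close;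
no census word moves; BSD is not proved by any of this. Flag `Cha05-Rmk25-structure` rides on §2.

References: [Kato2004Asterisque] §12.2, Thm. 12.4–12.6, 16.6, §17.13; [Rubin1998Durham] Prop. A.2; [Wuthrich2014]
p. 394, Cor. 18 (p. 398); [Kobayashi2006DocMath] Thm. 4.1; [GreenbergLNM1716] Thm. 1.5, Conj. 1.11; tree:
`Kato2004/DivisibilityInputsMultiplicative.lean`, `Theorems/ByReductionTypeAtTwoMultKatoRatOfInputs.lean` (bsd-2adic),
`Theorems/ErratumRoadFiveNonSurjCornerTwin{Kato,Mu,KatoRat}.lean` (this seat).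
-/

noncomputable section

open scoped Classical NumberField MatrixGroups ModularForm

namespace Summit.BirchSwinnertonDyer.Rank1Residual.X11b

open CongruenceSubgroup WeierstrassCurve NumberField IsDedekindDomain Field
  Literature.NumberTheory.EllipticCurves
  Literature.NumberTheory.EllipticCurves.ModularForms
  Literature.NumberTheory.EllipticCurves.Rank1Residual
  Literature.NumberTheory.EllipticCurves.Rank1Residual.Typed
  Literature.NumberTheory.EllipticCurves.Wuthrich2014
  Literature.NumberTheory.EllipticCurves.SteinWuthrich2013
  Literature.NumberTheory.EllipticCurves.Greenberg1999
  Literature.NumberTheory.QuadraticFields.Quadratic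
  Summit.BirchSwinnertonDyer.Rank1Residual
  Summit.BirchSwinnertonDyer.Rank1Residual.X11b.Three.Koly
  Summit.BirchSwinnertonDyer.BirchSwinnertonDyer.Theorems

/-! ### §1 x11c's typed divisibility at ANY odd multiplicative pair from named facts + `μ = 0` -/

/-- **`X11b.MultDivisibilityAt W p` at an odd multiplicative prime from SIX NAMED Literature facts and `μ = 0`.**
Facts: `hne : Kato2004.nonempty_iwasawaH1Data`, `h12 : Kato2004.thm12_4`,
`hns : Kato2004.exists_multDivisibilityInputs_nonsplit`, `hsp : Kato2004.exists_multDivisibilityInputs_split`,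
`h15 : Greenberg1999.thm15_isTorsion_multiplicative_rat`, `h18 : Wuthrich2014.corollary18_…_multiplicative`;
shape: `hμ` (`μ(X(E/ℚ_∞)) = 0` for every cyclotomic dual datum). Chain: bsd-2adic's
`MultKatoRat.katoMultiplicativeDivisibilityRat_of_facts_odd` (kernel: Kato's §17.13 module theory,
`KatoDivisibilitySkeletonProofs` ∕ `KatoDivisibilityExceptionalZeroSkeletonProofs`) gives
`X5.O1.KatoMultiplicativeDivisibilityRat W p`; this seat's `multDivisibilityAt_of_katoMultRat_of_corollary18_of_mu_eq_zero`
absorbs the period ratio and the power of `p` (`(p)` prime in `ℤ_p⟦T⟧`, `μ = 0`). NO image hypothesis.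
[cite: Kato2004Asterisque, Thm. 12.4 (p. 221), Thm. 12.5–12.6 (p. 222), Thm. 16.6 (p. 271), §17.13 (pp. 279–280)]
[cite: Rubin1998Durham, Prop. A.2 (iii)] [cite: Wuthrich2014, p. 394 and Cor. 18 (p. 398)]
[cite: Kobayashi2006DocMath, Thm. 4.1] [cite: GreenbergLNM1716, Thm. 1.5 (PDF p. 61) and Conj. 1.11 (shape)] -/
theorem multDivisibilityAt_of_katoFacts_of_corollary18_of_mu_eq_zero
    (hne : Kato2004.nonempty_iwasawaH1Data) (h12 : Kato2004.thm12_4)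
    (hns : Kato2004.exists_multDivisibilityInputs_nonsplit)
    (hsp : Kato2004.exists_multDivisibilityInputs_split)
    (h15 : thm15_isTorsion_multiplicative_rat)
    (h18 : Wuthrich2014.corollary18_padicLFunction_mem_iwasawaAlgebra_multiplicative)
    (W : WeierstrassCurve ℚ) [W.IsElliptic] [W.IsGloballyMinimal] (p : ℕ) [Fact p.Prime]
    (hp : p ≠ 2) (hmult : Mult W p)
    (hμ : ∀ (κ : ZpExtension ℚ p) (γ : Field.absoluteGaloisGroup ℚ),
      κ.IsCyclotomic → κ.IsTopGenerator γ → IsCyclotomicVariable p γ →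
      ∀ D : W.SelmerDualData κ γ, D.mu = 0) :
    MultDivisibilityAt W p :=
  multDivisibilityAt_of_katoMultRat_of_corollary18_of_mu_eq_zero h18 W p hp hmult
    (MultKatoRat.katoMultiplicativeDivisibilityRat_of_facts_odd W p hp hne h12 hns hsp h15) hμ

/-! ### §2 The corner: the twin summand is `μ = 0` ALONE modulo named facts -/

/-- **`NonSurjCorner` modulo NAMED facts + EulerHalfOffLocus (19062) + X11aLowerHalf (19064) + Zₚᶜ + [`μ = 0` at
the leaf twins] — nothing else.** p454452's
`erratumRoadFive_nonSurjCorner_of_certificates_of_lowerX11a_of_twinMultDivisibility` with `hdiv` (x11c's typed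
divisibility on the non-surjective X11a leaf at `p ∈ {5,7}`) DISCHARGED by §1 from the six named facts and `hμ`.
PUBLISHED binders as in p454452 plus `hne`, `h12`, `hns`, `hsp`, `h15`, `h18`. CONDITIONAL on `h₂`, `h₄`, `hZ`,
`hμ`; does NOT close item 19065; nothing booked.
[cite: Kato2004Asterisque, Thm. 17.4 (p. 273), §17.13 (pp. 279–280)] [cite: Wuthrich2014, Cor. 18 (p. 398)]
[cite: GreenbergLNM1716, Thm. 1.5 (PDF p. 61); §1 Conj. 1.11 (shape of μ = 0)]
[cite: Cha2005, Rmk. 25 (p. 175)] [cite: MatarNekovar2019, Thm. 0.3, §0.9, §0.11 (pp. 456–457)]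
[cite: WZhang2014, Thm. 1.1 and Rem. 5 (shape of Zₚᶜ)] [cite: SteinWuthrich2013, Thm. 6.1 (p. 20)]
[cite: JetchevSkinnerWan2017, §7.4.1–7.4.2 (pp. 30–31)] -/
theorem erratumRoadFive_nonSurjCorner_of_certificates_of_lowerX11a_of_katoFacts_of_twinMuZero
    (hGZ : ∀ (N : ℕ) [NeZero N] (W : WeierstrassCurve ℚ) (K : Type) [Field K] [NumberField K],
      gross_zagier N W K)
    (hKo : ∀ (N : ℕ) [NeZero N] (W : WeierstrassCurve ℚ) (K : Type) [Field K] [NumberField K],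
      kolyvagin N W K)
    (hWu : sha_dvd_analyticSha)
    (hMN : ∀ (N : ℕ) [NeZero N] (W : WeierstrassCurve ℚ) (K : Type) [Field K] [NumberField K],
      MatarNekovar2019.thm03_padicValNat_card_sha_le_of_irreducible N W K)
    (hGZK : rank_eq_analyticRank_of_analyticRank_le_one) (hmod : hasEntireLFunction_rat)
    (hnf : exists_isNewformOf) (hpar : nonempty_modularParametrizationData)
    (hFHs : friedbergHoffstein_exists_heegnerField_split_twist_ne_zero)
    (hMaz : mazur_not_dvd_maninConstant_of_odd)
    (hrec : ∀ (N : ℕ) [NeZero N] (W : WeierstrassCurve ℚ) (K : Type) [Field K] [NumberField K],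
      heegnerPointOfConductor_one_galoisConj N W K)
    (hD36 : ∀ (N : ℕ) [NeZero N] (W : WeierstrassCurve ℚ) (K : Type) [Field K] [NumberField K],
      phi_heegnerTau_mem_singularModuliField N W K)
    (hJs : thm61_splitMultiplicative) (hJn : thm61_nonsplitMultiplicative)
    (hGS : ∀ (W : WeierstrassCurve ℚ) [W.IsElliptic] [W.IsGloballyMinimal] (p : ℕ) [Fact p.Prime],
      greenberg_stevens (W := W) (p := p))
    (hChaL : Cha2005.rmk25_pow_dvd_card_sha_primary_of_certificate)
    -- the six named facts of the twin's Euler-system half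
    (hne : Kato2004.nonempty_iwasawaH1Data) (h12 : Kato2004.thm12_4)
    (hns : Kato2004.exists_multDivisibilityInputs_nonsplit)
    (hsp : Kato2004.exists_multDivisibilityInputs_split)
    (h15 : thm15_isTorsion_multiplicative_rat)
    (h18 : Wuthrich2014.corollary18_padicLFunction_mem_iwasawaAlgebra_multiplicative)
    (h₂ : Summit.BirchSwinnertonDyer.BirchSwinnertonDyer.Theses.ErratumRoadFive.EulerHalfOffLocus)
    (h₄ : Summit.BirchSwinnertonDyer.BirchSwinnertonDyer.Theses.ErratumRoadFive.X11aLowerHalf)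
    -- Zₚᶜ: certificates on corner frames (`M_∞ ≤ t`)
    (hZ : ∀ (W : WeierstrassCurve ℚ) [W.IsElliptic] [W.IsGloballyMinimal] (p : ℕ) [Fact p.Prime]
      (N : ℕ) [NeZero N] (K : Type) [Field K] [NumberField K]
      (Dt : ModularParametrizationData W N) (β : ℤ) (ι : K →+* ℂ),
      ClassX11b W p → ¬ Surj W p → (p = 5 ∨ p = 7) → p ∣ padicValInt p W.minimalDiscriminantInt →
      ¬ Ram W p → W.conductorNorm ℤ = N → IsImaginaryQuadratic K →
      4 < (NumberField.discr K).natAbs → SatisfiesHeegnerHypothesis N K →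
      SatisfiesHeegnerHypothesis p K → (4 * (N : ℤ)) ∣ β ^ 2 - NumberField.discr K → ¬ (p : ℤ) ∣ Dt.c →
      ∃ M : ℕ, M ≤ padicValNat p W.tamagawaProduct ∧ CertificateAt Dt β ι p M)
    -- Greenberg's μ = 0 at the leaf twins (rung K6's object; hypothesis shape) — the ONLY twin input left
    (hμ : ∀ (Wd : WeierstrassCurve ℚ) [Wd.IsElliptic] [Wd.IsGloballyMinimal] (p : ℕ) [Fact p.Prime],
      ClassX11a Wd p → ¬ Surj Wd p → (p = 5 ∨ p = 7) → p ∣ padicValInt p Wd.minimalDiscriminantInt →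
      ∀ (κ : ZpExtension ℚ p) (γ : Field.absoluteGaloisGroup ℚ),
        κ.IsCyclotomic → κ.IsTopGenerator γ → IsCyclotomicVariable p γ →
        ∀ D : Wd.SelmerDualData κ γ, D.mu = 0) :
    Summit.BirchSwinnertonDyer.BirchSwinnertonDyer.Theses.ErratumRoadFive.NonSurjCorner :=
  erratumRoadFive_nonSurjCorner_of_certificates_of_lowerX11a_of_twinMultDivisibility hGZ hKo hWu hMN hGZK
    hmod hnf hpar hFHs hMaz hrec hD36 hJs hJn hGS hChaL h₂ h₄ hZ
    (fun Wd _ _ p _ hXa hnsd h57 hvd ↦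
      multDivisibilityAt_of_katoFacts_of_corollary18_of_mu_eq_zero hne h12 hns hsp h15 h18 Wd p hXa.2.1
        hXa.2.2.1 (hμ Wd p hXa hnsd h57 hvd))

/-- **`NonSurjCorner` modulo NAMED facts + X11aLowerHalf (19064) + Zₚᶜ + Jₚᶜ + [`μ = 0` at the leaf twins] — NO
`EulerHalfOffLocus`.** p454452's `erratumRoadFive_nonSurjCorner_of_refinedKolyvagin_of_lowerX11a_of_twinMultDivisibility`
with `hdiv` discharged by §1. CONDITIONAL on `h₄`, `hZ`, `hJ`, `hμ`; does NOT close item 19065; nothing booked.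
[cite: Cha2005, Thm. 21 and Rmk. 25 (pp. 173–175)] [cite: MatarNekovar2019, Thm. 0.7, §0.9, §0.11 (pp. 456–457)]
[cite: McCallumLMS1991, §5 Cor. 5.6 (p. 310)] [cite: WZhang2014, Thm. 1.1 and Rem. 5 (shape of Zₚᶜ)]
[cite: Jetchev2008, Conj. 1.3 (shape of Jₚᶜ)] [cite: Kato2004Asterisque, Thm. 17.4 (p. 273), §17.13 (pp. 279–280)]
[cite: Wuthrich2014, Cor. 18 (p. 398)] [cite: GreenbergLNM1716, Thm. 1.5 (PDF p. 61); §1 Conj. 1.11 (shape of μ = 0)] -/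
theorem erratumRoadFive_nonSurjCorner_of_refinedKolyvagin_of_lowerX11a_of_katoFacts_of_twinMuZero
    (hGZ : ∀ (N : ℕ) [NeZero N] (W : WeierstrassCurve ℚ) (K : Type) [Field K] [NumberField K],
      gross_zagier N W K)
    (hKo : ∀ (N : ℕ) [NeZero N] (W : WeierstrassCurve ℚ) (K : Type) [Field K] [NumberField K],
      kolyvagin N W K)
    (hWu : sha_dvd_analyticSha)
    (hGZK : rank_eq_analyticRank_of_analyticRank_le_one) (hmod : hasEntireLFunction_rat)
    (hnf : exists_isNewformOf) (hpar : nonempty_modularParametrizationData)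
    (hFHs : friedbergHoffstein_exists_heegnerField_split_twist_ne_zero)
    (hMaz : mazur_not_dvd_maninConstant_of_odd)
    (hrec : ∀ (N : ℕ) [NeZero N] (W : WeierstrassCurve ℚ) (K : Type) [Field K] [NumberField K],
      heegnerPointOfConductor_one_galoisConj N W K)
    (hD36 : ∀ (N : ℕ) [NeZero N] (W : WeierstrassCurve ℚ) (K : Type) [Field K] [NumberField K],
      phi_heegnerTau_mem_singularModuliField N W K)
    (hJs : thm61_splitMultiplicative) (hJn : thm61_nonsplitMultiplicative)
    (hGS : ∀ (W : WeierstrassCurve ℚ) [W.IsElliptic] [W.IsGloballyMinimal] (p : ℕ) [Fact p.Prime],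
      greenberg_stevens (W := W) (p := p))
    (hChaL : Cha2005.rmk25_pow_dvd_card_sha_primary_of_certificate)
    (hChaU : Cha2005.rmk25_padicValNat_card_sha_primary_add_le_of_globalDivisibility)
    -- the six named facts of the twin's Euler-system half
    (hne : Kato2004.nonempty_iwasawaH1Data) (h12 : Kato2004.thm12_4)
    (hns : Kato2004.exists_multDivisibilityInputs_nonsplit)
    (hsp : Kato2004.exists_multDivisibilityInputs_split)
    (h15 : thm15_isTorsion_multiplicative_rat)
    (h18 : Wuthrich2014.corollary18_padicLFunction_mem_iwasawaAlgebra_multiplicative)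
    (h₄ : Summit.BirchSwinnertonDyer.BirchSwinnertonDyer.Theses.ErratumRoadFive.X11aLowerHalf)
    -- Zₚᶜ: certificates on corner frames (`M_∞ ≤ t`)
    (hZ : ∀ (W : WeierstrassCurve ℚ) [W.IsElliptic] [W.IsGloballyMinimal] (p : ℕ) [Fact p.Prime]
      (N : ℕ) [NeZero N] (K : Type) [Field K] [NumberField K]
      (Dt : ModularParametrizationData W N) (β : ℤ) (ι : K →+* ℂ),
      ClassX11b W p → ¬ Surj W p → (p = 5 ∨ p = 7) → p ∣ padicValInt p W.minimalDiscriminantInt →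
      ¬ Ram W p → W.conductorNorm ℤ = N → IsImaginaryQuadratic K →
      4 < (NumberField.discr K).natAbs → SatisfiesHeegnerHypothesis N K →
      SatisfiesHeegnerHypothesis p K → (4 * (N : ℤ)) ∣ β ^ 2 - NumberField.discr K → ¬ (p : ℤ) ∣ Dt.c →
      ∃ M : ℕ, M ≤ padicValNat p W.tamagawaProduct ∧ CertificateAt Dt β ι p M)
    -- Jₚᶜ: the Jetchev direction on corner frames (`M_∞ ≥ t`)
    (hJ : ∀ (W : WeierstrassCurve ℚ) [W.IsElliptic] [W.IsGloballyMinimal] [NeZero (W.conductorNorm ℤ)]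
      (p : ℕ) [Fact p.Prime] (K : Type) [Field K] [NumberField K]
      (Dt : ModularParametrizationData W (W.conductorNorm ℤ)) (β : ℤ) (ι : K →+* ℂ),
      ClassX11b W p → ¬ Surj W p → (p = 5 ∨ p = 7) → p ∣ padicValInt p W.minimalDiscriminantInt →
      ¬ Ram W p → IsImaginaryQuadratic K → 4 < (NumberField.discr K).natAbs →
      SatisfiesHeegnerHypothesis (W.conductorNorm ℤ) K → SatisfiesHeegnerHypothesis p K →
      (4 * (W.conductorNorm ℤ : ℤ)) ∣ β ^ 2 - NumberField.discr K → ¬ (p : ℤ) ∣ Dt.c →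
      ∀ (s : ℕ), s ≤ padicValNat p W.tamagawaProduct →
        ∀ (n : ℕ) (d : KolyvaginHeegnerData Dt β ι n), Squarefree n →
          (∀ ℓ ∈ n.primeFactors, Zhang2014.IsKolyvaginPrime (W.conductorNorm ℤ) W K p ℓ ∧
            s ≤ Zhang2014.kolyvaginIndex W p ℓ) → PDiv d p s)
    -- Greenberg's μ = 0 at the leaf twins (rung K6's object; hypothesis shape) — the ONLY twin input left
    (hμ : ∀ (Wd : WeierstrassCurve ℚ) [Wd.IsElliptic] [Wd.IsGloballyMinimal] (p : ℕ) [Fact p.Prime],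
      ClassX11a Wd p → ¬ Surj Wd p → (p = 5 ∨ p = 7) → p ∣ padicValInt p Wd.minimalDiscriminantInt →
      ∀ (κ : ZpExtension ℚ p) (γ : Field.absoluteGaloisGroup ℚ),
        κ.IsCyclotomic → κ.IsTopGenerator γ → IsCyclotomicVariable p γ →
        ∀ D : Wd.SelmerDualData κ γ, D.mu = 0) :
    Summit.BirchSwinnertonDyer.BirchSwinnertonDyer.Theses.ErratumRoadFive.NonSurjCorner :=
  erratumRoadFive_nonSurjCorner_of_refinedKolyvagin_of_lowerX11a_of_twinMultDivisibility hGZ hKo hWu hGZK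
    hmod hnf hpar hFHs hMaz hrec hD36 hJs hJn hGS hChaL hChaU h₄ hZ hJ
    (fun Wd _ _ p _ hXa hnsd h57 hvd ↦
      multDivisibilityAt_of_katoFacts_of_corollary18_of_mu_eq_zero hne h12 hns hsp h15 h18 Wd p hXa.2.1
        hXa.2.2.1 (hμ Wd p hXa hnsd h57 hvd))

end Summit.BirchSwinnertonDyer.Rank1Residual.X11b

end
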